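import Literature.Geometry.DiscreteGeometry.ThreePointBoundGeneral
import Summits.Ventures.PackingBounds.Energy.TenPointPetQ3Facc1
import Summits.Ventures.PackingBounds.Energy.TenPointPetQ3Fgrp2
import Summits.Ventures.PackingBounds.Energy.TenPointPetQ3Fblk0
import Summits.Ventures.PackingBounds.Energy.TenPointPetQ3Fblk1
import Summits.Ventures.PackingBounds.Energy.TenPointPetQ3Fblk2
import Summits.Ventures.PackingBounds.Energy.TenPointPetQ3Fblk3
import Summits.Ventures.PackingBounds.Energy.TenPointPetQ3Fblk4
import Summits.Ventures.PackingBounds.Energy.TenPointPetQ3Fblk5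
import HarnessLib

/-!
# `TenPointPetQ3`: the tree's factored three-point function `threePointF 4 6 6 dcoKPQ3 gwKPQ3` equals the expansion `FexpKPQ3`

Framing: lottery ticket; floor = certified bounds/negative ranges. Venture `PackingBounds`, cell
`pub-packcert`, energy family E3PT (pub-packcert-energy gen 14; n = 4 kernel route = KERNEL-D6 data route + `threePointF 4`).
-/

noncomputable section

open Finset

namespace Summit.Ventures.PackingBounds.Energy.TenPointPetQ3

open Literature.Geometry.DiscreteGeometry Literature.Geometry.DiscreteGeometry.BachocVallentin

/-- `Σ_{k<6} f k` written out. -/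
private theorem sum_range_blocksPQ3 (f : ℕ → ℝ) : ∑ k ∈ range 6, f k = f 0 + f 1 + f 2 + f 3 + f 4 + f 5 := by
  simp [Finset.sum_range_succ]

set_option maxRecDepth 20000 in
set_option maxHeartbeats 400000000 in
/-- The last staged partial sum lands on `FexpKPQ3` (`ring`). -/
theorem fgrp_top_eqPQ3 (u v t : ℝ) : Facc1KPQ3 u v t + Fgrp2KPQ3 u v t = FexpKPQ3 u v t := by
  unfold Facc1KPQ3 Fgrp2KPQ3 FexpKPQ3
  ring

/-- The tree's factored three-point function (`ThreePointBoundGeneral.threePointF`, `n = 4`) equals `FexpKPQ3` (blockwise identities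
`fblk<k>_eq`, staged sums, `linear_combination`). -/
theorem threePointF_eqPQ3 (u v t : ℝ) : threePointF 4 6 6 dcoKPQ3 gwKPQ3 u v t = FexpKPQ3 u v t := by
  rw [threePointF, sum_range_blocksPQ3, fblk0_eqPQ3, fblk1_eqPQ3, fblk2_eqPQ3, fblk3_eqPQ3, fblk4_eqPQ3, fblk5_eqPQ3]
  linear_combination fgrp0_eqPQ3 u v t + fgrp1_eqPQ3 u v t + fgrp2_eqPQ3 u v t + facc1_eqPQ3 u v t + fgrp_top_eqPQ3 u v t

end Summit.Ventures.PackingBounds.Energy.TenPointPetQ3
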